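import Summits.CriticalPhenomena.PercolationContinuityZ3.Theorems.Transplant.CayleyScaledQuasiLine
import HarnessLib

/-!
# EVERY Cayley graph of the Heisenberg group `H₃(ℤ)` — every finite generating set — has `θ(p_c) = 0` modulo the scaled one-type node ALONE

builds on p205010 (kernel theorem, internal audit signed; external expert review pending) — nothing in this file uses p205010.  The percolation
conclusion is CONDITIONAL on the OPEN node `SamePDropOfSkeletonFrmScaled₁` (hypothesis `hN`; nothing is claimed about it); Φ2 is UNCONDITIONAL
(the central coordinate is a height that is Lipschitz inside every tube).  Lane `prim-bschramm`, seat `prim-bschramm-p4` gen 16 (PART C3 of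
`P4-GENERAL.md` §38: ARBITRARY GENERATING SETS).  Helper file (`--supports stmt-CriticalPhenomena-4575 --as helper`).

Earlier Heisenberg rows needed a UNIT-STEP generating set `S ∋ a, b` with planar letters of sup-norm `≤ 1` (`HeisGens`, `HeisGRR`, `Cay(H₃;S)`
files) — and, for the unconditional ones, an `S`-preserving automorphism.  Here: `S ⊂ H₃(ℤ)` is ANY finite generating set (e.g. `{a, b, a⁵}^±`,
`{a²b, ab², a³}^±`, sets with no unit planar step at all), the chart is the abelianisation re-based on a maximal-area pair of generator images
(`CayleyScaled`), the kernel is the centre `⟨c⟩`, and the height `z` is Lipschitz along edges inside each tube `‖ψ‖_∞ ≤ m`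
(`|Δz| ≤ |s_z| + |x|·|s_y|` with `|x|` bounded on the tube).
* `Heis3` — the group `H₃(ℤ)` on coordinates `(x, y, z)` with `(x,y,z)(x',y',z') = (x+x', y+y', z+z'+x y')` (Mathlib `Group` instance);
* `Heis3.scaled S hS : CayleyScaled Heis3 S` for every finite generating `S`; `Heis3.z_lip` (tube-Lipschitz height);
* **`Heis3.criticalContinuity_of_frmScaledNode₁ : SamePDropOfSkeletonFrmScaled₁ → ∀ S generating, ∀ g, θ_g(p_c(Cay(H₃(ℤ); S))) = 0`.**
[cite: BenjaminiSchramm1996, Conj. 4; §2 (Cayley graphs)] [cite: GrimmettPercolation1999, §1.4 (one dimension: p_c = 1)]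
[cite: KozmaNitzan2024, §1 p. 2 (approach 1)]
-/

noncomputable section

namespace Summit.CriticalPhenomena.PercolationContinuityZ3.Theorems.Transplant

open SimpleGraph Subgroup Literature.Probability.LatticeModels Literature.Probability.Percolation
open scoped Classical

/-- **The discrete Heisenberg group `H₃(ℤ)`** on coordinates `(x, y, z)` (upper unitriangular integer matrices; law `z″ = z + z′ + x y′`).
[cite: BenjaminiSchramm1996, §2 (Cayley graphs)] -/
@[ext] structure Heis3 where
  /-- abelianisation coordinate `x` -/
  x : ℤ
  /-- abelianisation coordinate `y` -/
  y : ℤ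
  /-- central coordinate `z` -/
  z : ℤ
deriving DecidableEq

namespace Heis3

/-- Multiplication `(x,y,z)·(x′,y′,z′) = (x+x′, y+y′, z+z′+x y′)`. [folklore] -/
instance : Mul Heis3 := ⟨fun g h => ⟨g.x + h.x, g.y + h.y, g.z + h.z + g.x * h.y⟩⟩

/-- The identity `(0,0,0)`. [folklore] -/
instance : One Heis3 := ⟨⟨0, 0, 0⟩⟩

/-- Inversion `(x,y,z)⁻¹ = (−x, −y, −z + x y)`. [folklore] -/
instance : Inv Heis3 := ⟨fun g => ⟨-g.x, -g.y, -g.z + g.x * g.y⟩⟩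

/-- `x`-coordinate of a product. [folklore] -/
@[simp] theorem mul_x (g h : Heis3) : (g * h).x = g.x + h.x := rfl
/-- `y`-coordinate of a product. [folklore] -/
@[simp] theorem mul_y (g h : Heis3) : (g * h).y = g.y + h.y := rfl
/-- `z`-coordinate of a product. [folklore] -/
@[simp] theorem mul_z (g h : Heis3) : (g * h).z = g.z + h.z + g.x * h.y := rfl
/-- `x`-coordinate of the identity. [folklore] -/
@[simp] theorem one_x : (1 : Heis3).x = 0 := rfl
/-- `y`-coordinate of the identity. [folklore] -/
@[simp] theorem one_y : (1 : Heis3).y = 0 := rfl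
/-- `z`-coordinate of the identity. [folklore] -/
@[simp] theorem one_z : (1 : Heis3).z = 0 := rfl
/-- `x`-coordinate of an inverse. [folklore] -/
@[simp] theorem inv_x (g : Heis3) : g⁻¹.x = -g.x := rfl
/-- `y`-coordinate of an inverse. [folklore] -/
@[simp] theorem inv_y (g : Heis3) : g⁻¹.y = -g.y := rfl
/-- `z`-coordinate of an inverse. [folklore] -/
@[simp] theorem inv_z (g : Heis3) : g⁻¹.z = -g.z + g.x * g.y := rfl

/-- **`H₃(ℤ)` is a group.** [folklore] -/
instance : Group Heis3 where
  mul_assoc a b c := by ext <;> simp <;> ring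
  one_mul a := by ext <;> simp
  mul_one a := by ext <;> simp
  inv_mul_cancel a := by ext <;> simp

/-- Generator `a = (1,0,0)`. [folklore] -/
def gA : Heis3 := ⟨1, 0, 0⟩
/-- Generator `b = (0,1,0)`. [folklore] -/
def gB : Heis3 := ⟨0, 1, 0⟩
/-- Central element `c = (0,0,1)` (`= [a,b]`). [folklore] -/
def gC : Heis3 := ⟨0, 0, 1⟩

/-- Powers of `c`: `c^k = (0,0,k)`. [folklore] -/
theorem gC_zpow (k : ℤ) : gC ^ k = ⟨0, 0, k⟩ := by
  induction k using Int.induction_on with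
  | zero => rw [zpow_zero]; rfl
  | succ n ih => rw [zpow_add_one, ih]; ext <;> simp [gC]
  | pred n ih => rw [zpow_sub_one, ih]; (ext <;> simp [gC]); omega

/-- **The chart: the abelianisation `(x, y)`.** [cite: KozmaNitzan2024, §4 p. 16 (Lemma 8)] -/
def φ (g : Heis3) : Site 2 := fun i => if i = 0 then g.x else g.y

/-- Coordinate `0` of the chart. [folklore] -/
@[simp] theorem φ_zero (g : Heis3) : φ g 0 = g.x := rfl

/-- Coordinate `1` of the chart. [folklore] -/
@[simp] theorem φ_one' (g : Heis3) : φ g 1 = g.y := rfl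

/-- The chart is additive. [folklore] -/
theorem φ_mul (g h : Heis3) : φ (g * h) = φ g + φ h := by
  funext i; fin_cases i <;> simp

/-- **The chart and the height `z` separate points.** [folklore] -/
theorem injective_φ_z : Function.Injective fun g : Heis3 => (φ g, g.z) := by
  intro g h hgh
  simp only [Prod.mk.injEq] at hgh
  obtain ⟨h1, h2⟩ := hgh
  ext
  · exact congrFun h1 0
  · exact congrFun h1 1
  · exact h2

/-- **The kernel of the chart is the centre `⟨c⟩`.** [folklore] -/
theorem ker_φ (g : Heis3) (hg : φ g = 0) : g ∈ Subgroup.closure ({gC} : Set Heis3) := by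
  rw [Subgroup.mem_closure_singleton]
  refine ⟨g.z, ?_⟩
  rw [gC_zpow]
  have hx : g.x = 0 := congrFun hg 0
  have hy : g.y = 0 := congrFun hg 1
  ext <;> simp [hx, hy]

variable (S : Finset Heis3)

/-- **The scaled datum of `Cay(H₃(ℤ); S)` for EVERY finite generating `S`** (kernel `⟨c⟩`, rank witnesses `a, b`).
[cite: BenjaminiSchramm1996, §2 (Cayley graphs)] -/
def scaled (hS : Subgroup.closure (S : Set Heis3) = ⊤) : CayleyScaled Heis3 S :=
  CayleyScaled.ofRank φ φ_mul hS ⟨gA, gB, by simp [MaxArea.det2, gA, gB]⟩ {gC}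
    (fun k hk => by rw [Finset.mem_singleton] at hk; subst hk; funext i; fin_cases i <;> rfl)
    (fun g hg => by rw [Finset.coe_singleton]; exact ker_φ g hg)

/-- **The central coordinate is Lipschitz along edges inside every tube**: if `|a.x| ≤ M` and `b = a·s^{±1}` with `s ∈ S`, then
`|a.z − b.z| ≤ max_s |s_z| + M · max_s |s_y|`. [folklore] -/
theorem z_lip {M : ℕ} {a b : Heis3} (h : (mulCayley (S : Set Heis3)).Adj a b) (ha : |a.x| ≤ M) (hb : |b.x| ≤ M) :
    |a.z - b.z| ≤ S.sup (fun s => s.z.natAbs) + M * S.sup (fun s => s.y.natAbs) := by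
  -- along an edge one endpoint is the other times a generator
  have key : ∀ {a b : Heis3}, a⁻¹ * b ∈ S → |a.x| ≤ M →
      |a.z - b.z| ≤ S.sup (fun s => s.z.natAbs) + M * S.sup (fun s => s.y.natAbs) := by
    intro a b hs ha
    set s := a⁻¹ * b with hsd
    have hb' : b = a * s := by rw [hsd, mul_inv_cancel_left]
    have h1 : s.z.natAbs ≤ S.sup (fun s => s.z.natAbs) :=
      Finset.le_sup (f := fun s : Heis3 => s.z.natAbs) hs
    have h2 : s.y.natAbs ≤ S.sup (fun s => s.y.natAbs) := Finset.le_sup (f := fun s : Heis3 => s.y.natAbs) hs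
    have hz : a.z - b.z = -(s.z + a.x * s.y) := by rw [hb', mul_z]; ring
    rw [hz, abs_neg]
    have e1 : ((s.z.natAbs : ℕ) : ℤ) = |s.z| := Int.natCast_natAbs _
    have e2 : ((s.y.natAbs : ℕ) : ℤ) = |s.y| := Int.natCast_natAbs _
    have h1' : |s.z| ≤ ((S.sup (fun s => s.z.natAbs) : ℕ) : ℤ) := by
      rw [← e1]; exact_mod_cast h1
    have h2' : |s.y| ≤ ((S.sup (fun s => s.y.natAbs) : ℕ) : ℤ) := by rw [← e2]; exact_mod_cast h2
    calc |s.z + a.x * s.y| ≤ |s.z| + |a.x * s.y| := abs_add_le _ _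
      _ = |s.z| + |a.x| * |s.y| := by rw [abs_mul]
      _ ≤ |s.z| + M * |s.y| := by nlinarith [mul_le_mul_of_nonneg_right ha (abs_nonneg s.y)]
      _ ≤ _ := by nlinarith [abs_nonneg s.y]
  rw [mulCayley_adj] at h
  obtain ⟨-, h | h⟩ := h
  · exact key (Finset.mem_coe.1 h) ha
  · rw [abs_sub_comm]; exact key (Finset.mem_coe.1 h) hb

/-- **THEOREM (modulo the scaled node): EVERY Cayley graph of `H₃(ℤ)` has `θ_g(p_c) = 0` at every vertex** — `S` ANY finite generating set of
the Heisenberg group (no unit planar steps, no range condition, no `S`-preserving automorphism required); Φ2 is free (the central height inside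
tubes), `p_c < 1`, uniqueness and quasi-transitivity are derived. [cite: BenjaminiSchramm1996, Conj. 4; §2] [cite: KozmaNitzan2024, §1 p. 2 (approach 1)] -/
theorem criticalContinuity_of_frmScaledNode₁ (hN : SamePDropOfSkeletonFrmScaled₁) (hS : Subgroup.closure (S : Set Heis3) = ⊤) (g : Heis3) :
    theta (mulCayley (S : Set Heis3)) g (criticalProbIOf (mulCayley (S : Set Heis3)) g) = 0 := by
  refine (scaled S hS).criticalContinuity_of_height hN (fun g => g.z) injective_φ_z (fun m => ?_) g
  set M : ℕ := (scaled S hS).chartBound m with hM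
  refine ⟨S.sup (fun s => s.z.natAbs) + M * S.sup (fun s => s.y.natAbs), fun a b hab ha hb => ?_⟩
  have ha' := (scaled S hS).φ_mem_box_of_ψ_mem_box ha
  have hb' := (scaled S hS).φ_mem_box_of_ψ_mem_box hb
  rw [mem_box] at ha' hb'
  have hax : |a.x| ≤ M := by rw [abs_le]; exact ha' 0
  have hbx : |b.x| ≤ M := by rw [abs_le]; exact hb' 0
  exact z_lip S hab hax hbx

end Heis3

end Summit.CriticalPhenomena.PercolationContinuityZ3.Theorems.Transplant

end
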